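import Summits.BirchSwinnertonDyer.Rank2.KubotaLeopoldtTwoRiemannSums
import HarnessLib

/-!
# The Riemann sums of the involute `G^ι(T)` in closed form and the bits of `ḡ^ι`

Cell `bsd-rank2` (D-0036), seat `bsd-rank2-eng` GEN 9 (director-bsd g9 ruling (R3): BC5 rung «(★_S) mod T⁸ on 15A8»,
Stage C′). The tree's `klTwoNumeratorInv = distributionTransform klTwoMeasureInv`, `klTwoMeasureInv = invUnitsDist klTwoMeasure`
(`μ̌(a) = μ(a⁻¹)` on unit classes). Since `5^{2^m} ≡ 1 (mod 2^m)`, `(5ˢ)⁻¹ = 5^{2^m − s}` in `ℤ/2^m`, so the Riemann sums of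
`G^ι` are the integers `klRSInv k n = 2·Σ_{s<2ⁿ} μ_{n+2}(5^{2ⁿ⁺²−s} mod 2ⁿ⁺²)·C(s,k)` (`distributionRiemannSum_klTwoMeasureInv_eq`);
with the truncation bound (`C = 1`) and the kernel table at `n = 6`:
**`coeff_klTwoNumeratorInv_mod_four`: `ḡ^ι = G^ι/2 ≡ 1 + T² + T⁴ + T⁵ (mod 2, T⁸)`** (`= ḡ(T^ι)`, `T^ι = (1+T)⁻¹ − 1`, as it must).

DEFINITIONS + THEOREMS (computable `def`; no named fact, no `sorry`). PARTITION: none — r_an ≥ 2, summit axis S0; TWIN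
(D-0056): n/a. B1 honesty: finite `2`-adic arithmetic; nothing reads an analytic rank; no S0 motion.

References: S. Lang, *Cyclotomic fields I and II* (1990), Ch. 4 §2–§3 [LangCyclotomic1990];
B. Mazur, J. Tate, J. Teitelbaum, *Invent. Math.* 84 (1986) §I.13 [MazurTateTeitelbaum1986Invent].
-/

namespace Summit.BirchSwinnertonDyer.Rank2.LevelFifteen

/-! ### §1 Computable data -/

/-- `RS_{G^ι}(k, n) = 2·Σ_{s<2ⁿ} μ_{n+2}(5^{2ⁿ⁺²−s} mod 2ⁿ⁺²)·C(s,k)`. [cite: MazurTateTeitelbaum1986Invent, §I.13] -/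
def klRSInv (k n : ℕ) : ℤ :=
  2 * sumBelow (fun s ↦ klMu (n + 2) (5 ^ (2 ^ (n + 2) - s) % 2 ^ (n + 2)) * (chooseFast s k : ℤ)) (2 ^ n)

/-- The table at `n = 6`, `k ≤ 7` (kernel evaluation). [folklore] -/
theorem kl_inv_tables_six :
    klRSInv 0 6 = 2 ∧ klRSInv 1 6 = 136 ∧ klRSInv 2 6 = 10506 ∧ klRSInv 3 6 = 315560 ∧ klRSInv 4 6 = 5712742 ∧
    klRSInv 5 6 = 74475962 ∧ klRSInv 6 6 = 759986820 ∧ klRSInv 7 6 = 6362311744 := by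
  decide +kernel

noncomputable section

open Filter Topology Finset
open Literature.NumberTheory.EllipticCurves

/-! ### §2 The Riemann sums of `G^ι` in closed form -/

/-- In `ℤ/2^m`: `(5ˢ)⁻¹ = 5^{2^m − s}` for `s ≤ 2^m`. [folklore] -/
theorem inv_five_pow_eq (m s : ℕ) (hs : s ≤ 2 ^ m) :
    ((((5 : ℕ) : ZMod (2 ^ m))) ^ s)⁻¹ = (((5 : ℕ) : ZMod (2 ^ m))) ^ (2 ^ m - s) := by
  refine ZMod.inv_eq_of_mul_eq_one _ _ _ ?_
  rw [← pow_add, Nat.add_sub_cancel' hs]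
  have h := two_pow_dvd_five_pow_two_pow_sub_one m
  have h' : (((5 ^ (2 ^ m) : ℤ)) : ZMod (2 ^ m)) = ((1 : ℤ) : ZMod (2 ^ m)) := by
    rw [ZMod.intCast_eq_intCast_iff_dvd_sub]
    have : (1 : ℤ) - 5 ^ 2 ^ m = -(5 ^ 2 ^ m - 1) := by ring
    rw [this, dvd_neg]
    exact_mod_cast h
  have h'' : (((5 : ℕ) : ZMod (2 ^ m))) ^ (2 ^ m) = 1 := by
    have := h'
    push_cast at this
    exact_mod_cast this
  exact h''

/-- **`distributionRiemannSum klTwoMeasureInv k n = klRSInv k n`.** [cite: MazurTateTeitelbaum1986Invent, §I.13]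
[cite: LangCyclotomic1990, Ch. 4 §2] -/
theorem distributionRiemannSum_klTwoMeasureInv_eq (k n : ℕ) :
    distributionRiemannSum klTwoMeasureInv k n = (klRSInv k n : ℚ_[2]) := by
  rw [distributionRiemannSum_two_of_even klTwoMeasureInv_neg k n, klRSInv, sumBelow_eq_sum_range]
  push_cast
  congr 1
  rw [← sum_zmod_val_eq_sum_range n (fun m ↦ (klMu (n + 2) (5 ^ (2 ^ (n + 2) - m) % 2 ^ (n + 2)) : ℚ_[2]) *
    (chooseFast m k : ℚ_[2]))]
  refine Finset.sum_congr rfl fun s _ ↦ ?_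
  haveI : Fact (1 < 2 ^ (n + 2)) := ⟨Nat.one_lt_two_pow (by omega)⟩
  have h5 : (cyclotomicGenerator 2 : ZMod (2 ^ (n + 2))) = (((5 : ℕ) : ZMod (2 ^ (n + 2)))) := by
    rw [cyclotomicGenerator_two]
  have hunit : IsUnit ((cyclotomicGenerator 2 : ZMod (2 ^ (n + 2))) ^ s.val) := by
    rw [h5]
    refine IsUnit.pow _ ?_
    rw [ZMod.isUnit_iff_coprime]
    exact (Nat.coprime_two_right.mpr (by decide : Odd 5)).pow_right _
  have hs : s.val ≤ 2 ^ (n + 2) := by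
    have := ZMod.val_lt s
    have : 2 ^ n ≤ 2 ^ (n + 2) := Nat.pow_le_pow_right (by norm_num) (by omega)
    omega
  rw [klTwoMeasureInv_apply_of_isUnit hunit, h5, inv_five_pow_eq (n + 2) s.val hs, klTwoMeasure_eq_klMu,
    ← Nat.cast_pow, ZMod.val_natCast, chooseFast_eq_choose]

/-! ### §3 The coefficients of `G^ι` modulo `4` -/

/-- Truncation for the involute: `‖G^ι_k − RS_{G^ι}(k, n)‖ ≤ 2^{−n}/‖k!‖`. [cite: MazurTateTeitelbaum1986Invent, §I.13] -/
theorem norm_coeff_klTwoNumeratorInv_sub_riemannSum_le (k n : ℕ) :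
    ‖PowerSeries.coeff k klTwoNumeratorInv - distributionRiemannSum klTwoMeasureInv k n‖ ≤
      1 / ‖((k.factorial : ℕ) : ℚ_[2])‖ * (2 : ℝ) ^ (-n : ℤ) := by
  set B : ℝ := 1 / ‖((k.factorial : ℕ) : ℚ_[2])‖ * (2 : ℝ) ^ (-n : ℤ) with hB
  have hstep : ∀ j, ‖distributionRiemannSum klTwoMeasureInv k (n + j + 1) -
      distributionRiemannSum klTwoMeasureInv k (n + j)‖ ≤ B := by
    intro j
    have h := norm_riemannSum_succ_sub_le_of_distribution (p := 2) (distributionRiemannSum_spec klTwoMeasureInv)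
      klTwoMeasureInv_distribution zero_le_one norm_klTwoMeasureInv_le_one k (n + j)
    refine h.trans ?_
    rw [hB]
    refine mul_le_mul_of_nonneg_left ?_ (by positivity)
    push_cast
    exact zpow_le_zpow_right₀ (by norm_num) (by omega)
  have hadd : ∀ j, ‖distributionRiemannSum klTwoMeasureInv k (n + j) -
      distributionRiemannSum klTwoMeasureInv k n‖ ≤ B := by
    intro j
    induction j with
    | zero => simp only [add_zero, sub_self, norm_zero]; positivity
    | succ j ih =>
      have hsplit : distributionRiemannSum klTwoMeasureInv k (n + (j + 1)) - distributionRiemannSum klTwoMeasureInv k n =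
          (distributionRiemannSum klTwoMeasureInv k (n + j + 1) - distributionRiemannSum klTwoMeasureInv k (n + j)) +
            (distributionRiemannSum klTwoMeasureInv k (n + j) - distributionRiemannSum klTwoMeasureInv k n) := by
        rw [← add_assoc]; ring
      rw [hsplit]
      exact (IsUltrametricDist.norm_add_le_max _ _).trans (max_le (hstep j) ih)
  have htend := tendsto_distributionRiemannSum_klTwoMeasureInv k
  have hshift : Tendsto (fun j ↦ distributionRiemannSum klTwoMeasureInv k (n + j)) atTop
      (𝓝 (PowerSeries.coeff k klTwoNumeratorInv)) := by
    have h := (Filter.tendsto_add_atTop_iff_nat n).mpr htend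
    simpa only [add_comm] using h
  have hlim : Tendsto (fun j ↦ ‖distributionRiemannSum klTwoMeasureInv k (n + j) -
      distributionRiemannSum klTwoMeasureInv k n‖)
      atTop (𝓝 ‖PowerSeries.coeff k klTwoNumeratorInv - distributionRiemannSum klTwoMeasureInv k n‖) :=
    (hshift.sub tendsto_const_nhds).norm
  exact le_of_tendsto' hlim hadd

/-- `‖2‖₂ = 1/2`. [folklore] -/
private theorem norm_two'' : ‖(2 : ℚ_[2])‖ = (2 : ℝ)⁻¹ := by
  have h := Padic.norm_p (p := 2); simpa using h

/-- **The first eight coefficients of `G^ι` modulo `4`: `ḡ^ι = G^ι/2 ≡ 1 + T² + T⁴ + T⁵ (mod 2, T⁸)`**: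
`‖G^ι_k/2 − b_k‖₂ ≤ 1/2` for `(k, b_k) = (0,1),(1,0),(2,1),(3,0),(4,1),(5,1),(6,0),(7,0)`.
[cite: MazurTateTeitelbaum1986Invent, §I.13] [cite: LangCyclotomic1990, Ch. 4 §2–§3] -/
theorem coeff_klTwoNumeratorInv_mod_four :
    ∀ kb ∈ [((0 : ℕ), (1 : ℤ)), (1, 0), (2, 1), (3, 0), (4, 1), (5, 1), (6, 0), (7, 0)],
      ‖PowerSeries.coeff kb.1 klTwoNumeratorInv / 2 - (kb.2 : ℚ_[2])‖ ≤ (2 : ℝ)⁻¹ := by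
  have herr : ∀ k : ℕ, k ≤ 7 → ‖PowerSeries.coeff k klTwoNumeratorInv - (klRSInv k 6 : ℚ_[2])‖ ≤ (2 : ℝ)⁻¹ ^ 2 := by
    intro k hk
    rw [← distributionRiemannSum_klTwoMeasureInv_eq]
    refine (norm_coeff_klTwoNumeratorInv_sub_riemannSum_le k 6).trans ?_
    have h3 : ‖((3 : ℤ) : ℚ_[2])‖ = 1 := le_antisymm (Padic.norm_int_le_one _) (not_lt.mp fun h ↦ by
      have h2 : (2 : ℤ) ∣ 3 := by exact_mod_cast (Padic.norm_intCast_lt_one_iff (p := 2)).mp h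
      omega)
    have h15 : ‖((15 : ℤ) : ℚ_[2])‖ = 1 := le_antisymm (Padic.norm_int_le_one _) (not_lt.mp fun h ↦ by
      have h2 : (2 : ℤ) ∣ 15 := by exact_mod_cast (Padic.norm_intCast_lt_one_iff (p := 2)).mp h
      omega)
    have h45 : ‖((45 : ℤ) : ℚ_[2])‖ = 1 := le_antisymm (Padic.norm_int_le_one _) (not_lt.mp fun h ↦ by
      have h2 : (2 : ℤ) ∣ 45 := by exact_mod_cast (Padic.norm_intCast_lt_one_iff (p := 2)).mp h
      omega)
    have h315 : ‖((315 : ℤ) : ℚ_[2])‖ = 1 := le_antisymm (Padic.norm_int_le_one _) (not_lt.mp fun h ↦ by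
      have h2 : (2 : ℤ) ∣ 315 := by exact_mod_cast (Padic.norm_intCast_lt_one_iff (p := 2)).mp h
      omega)
    have hfac : (2 : ℝ)⁻¹ ^ 4 ≤ ‖((k.factorial : ℕ) : ℚ_[2])‖ := by
      interval_cases k
      · norm_num [Nat.factorial]
      · norm_num [Nat.factorial]
      · rw [show ((Nat.factorial 2 : ℕ) : ℚ_[2]) = 2 by norm_num [Nat.factorial], norm_two'']; norm_num
      · rw [show ((Nat.factorial 3 : ℕ) : ℚ_[2]) = 2 * ((3 : ℤ) : ℚ_[2]) by norm_num [Nat.factorial], norm_mul,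
          norm_two'', h3]; norm_num
      · rw [show ((Nat.factorial 4 : ℕ) : ℚ_[2]) = 2 ^ 3 * ((3 : ℤ) : ℚ_[2]) by norm_num [Nat.factorial], norm_mul,
          norm_pow, norm_two'', h3]; norm_num
      · rw [show ((Nat.factorial 5 : ℕ) : ℚ_[2]) = 2 ^ 3 * ((15 : ℤ) : ℚ_[2]) by norm_num [Nat.factorial], norm_mul,
          norm_pow, norm_two'', h15]; norm_num
      · rw [show ((Nat.factorial 6 : ℕ) : ℚ_[2]) = 2 ^ 4 * ((45 : ℤ) : ℚ_[2]) by norm_num [Nat.factorial], norm_mul,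
          norm_pow, norm_two'', h45, mul_one]
      · rw [show ((Nat.factorial 7 : ℕ) : ℚ_[2]) = 2 ^ 4 * ((315 : ℤ) : ℚ_[2]) by norm_num [Nat.factorial], norm_mul,
          norm_pow, norm_two'', h315, mul_one]
    have hpos : (0 : ℝ) < ‖((k.factorial : ℕ) : ℚ_[2])‖ := lt_of_lt_of_le (by positivity) hfac
    rw [show (2 : ℝ) ^ (-((6 : ℕ) : ℤ)) = (2 : ℝ)⁻¹ ^ 6 by
      rw [zpow_neg, zpow_natCast, inv_pow]]
    calc 1 / ‖((k.factorial : ℕ) : ℚ_[2])‖ * (2 : ℝ)⁻¹ ^ 6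
        ≤ 1 / (2 : ℝ)⁻¹ ^ 4 * (2 : ℝ)⁻¹ ^ 6 := by gcongr
      _ = (2 : ℝ)⁻¹ ^ 2 := by norm_num
  obtain ⟨r0, r1, r2, r3, r4, r5, r6, r7⟩ := kl_inv_tables_six
  intro kb hkb
  simp only [List.mem_cons, List.mem_nil_iff, or_false] at hkb
  rcases hkb with rfl | rfl | rfl | rfl | rfl | rfl | rfl | rfl
  · exact norm_half_sub_le_of_int (herr 0 (by norm_num)) (by rw [r0]; norm_num)
  · exact norm_half_sub_le_of_int (herr 1 (by norm_num)) (by rw [r1]; norm_num)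
  · exact norm_half_sub_le_of_int (herr 2 (by norm_num)) (by rw [r2]; norm_num)
  · exact norm_half_sub_le_of_int (herr 3 (by norm_num)) (by rw [r3]; norm_num)
  · exact norm_half_sub_le_of_int (herr 4 (by norm_num)) (by rw [r4]; norm_num)
  · exact norm_half_sub_le_of_int (herr 5 (by norm_num)) (by rw [r5]; norm_num)
  · exact norm_half_sub_le_of_int (herr 6 (by norm_num)) (by rw [r6]; norm_num)
  · exact norm_half_sub_le_of_int (herr 7 (by norm_num)) (by rw [r7]; norm_num)

end

end Summit.BirchSwinnertonDyer.Rank2.LevelFifteen
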